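import Mathlib.Analysis.Calculus.IteratedDeriv.Lemmas
import Mathlib.Analysis.Calculus.ContDiff.Deriv
import Mathlib.Analysis.Calculus.MeanValue
import Mathlib.Analysis.Complex.Basic
import Mathlib.Analysis.Complex.Exponential
import HarnessLib

/-!
# Dixmier–Malliavin kernels on `ℝ`: derivative bounds AWAY FROM THE ORIGIN, uniform over the
# family of kernels — PROVED (the "annulus estimate")

Topic `Literature/Analysis/Convolution`.  Theorems only (no definition, no named fact); Mathlib-only
imports.  Companion of `DixmierMalliavin.lean` (the named fact `DixmierMalliavin_real`),
`DixmierMalliavinFactorization.lean` (the factorization step) and the kernel-construction modules.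

J. Dixmier, P. Malliavin, *Factorisations de fonctions et de vecteurs indéfiniment différentiables*,
Bull. Sci. Math. (2) **102** (1978) 305–330 [bib: `DixmierMalliavin1978`], §2–§3 (case `G = ℝ`);
D. Hegde, *Schwartz functions, Hadamard products, and the Dixmier–Malliavin theorem*,
arXiv:2103.05495 [bib: `Hegde2021`], §3.2 (Claim 13 and the proof of Lemma 14).

**The printed step.**  The Dixmier–Malliavin kernel is `ψ` with
`ψ̂(ξ) = 1 / Π_{n} (1 + ξ²/a_n²)` ([Hegde2021, §3.1 Lemma 10, §3.2 Claim 13]); writing `c_n = 1/(2π a_n)`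
it is the (infinite) convolution of the Laplace densities `p_{c_n}(x) = (2c_n)⁻¹ e^{−|x|/c_n}`.  With
`ψ_k` the kernel of the TAIL sequence `(c_n)_{n ≥ k}` one has the exact recursion
`ψ_k″ = (ψ_k − ψ_{k+1}) / c_k²` (because `p_c″ = (p_c − δ)/c²`), and, away from the origin, the decay
`|ψ_k(x)| ≤ (C/c_k) e^{−a/c_k}` for `|x| ≥ s`.  The proof of [Hegde2021, Lemma 14] needs, for the
commutator `Σ_j (−1)^j b_j ((ωψ)^{(2j)} − ωψ^{(2j)})` (supported where `ω′ ≠ 0`, i.e. in `1 ≤ |x| ≤ 2`),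
bounds `sup_{|x| ≥ 1} |ψ^{(m)}(x)| ≤ K_m` with `K_m` INDEPENDENT of the sequence — "we can choose
`c_n = sup |f^{(n)}(x)|` independent of the sequence `λ` … On `|x| ≥ 1`, `|b_j f^{(2n+j)}(x)| ≤ b_j c_{2n+j}`"
([Hegde2021, §3.2, proof of Lemma 14]) — so that the coefficients `b_j` can afterwards be chosen
against the `K_m`.

**Erratum recorded by this cell (not needed below).**  [Hegde2021, Claim 13] states the uniform bound
as a supremum over all of `ℝ`; that version fails (as the tail of the sequence shrinks, `ψ` tends to
the first Laplace kernel `π a₁ e^{−2π a₁ |x|}`, which is not `C¹` at `0`), and only the bound away from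
the origin — which is all the proof of Lemma 14 uses — holds.  This file proves the away-from-the-origin
bounds.

**What is here (abstract form; the kernel modules instantiate it).**  For ANY family
`ψ : ℕ → ℝ → E` of smooth functions and ANY positive antitone sequence `c` satisfying the recursion
`ψ_k″ = c_k⁻² • (ψ_k − ψ_{k+1})`:

* `KernelChain.norm_iteratedDeriv_two_mul_le_sum` — for all `x`,
  `‖ψ_k^{(2m)}(x)‖ ≤ 2^m Σ_{j ≤ m} c_{k+j}^{−2m} ‖ψ_{k+j}(x)‖` (induction on `m`; the only input on `c`
  is `c_{k+j} ≤ c_k`);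
* `KernelChain.norm_iteratedDeriv_two_mul_le_of_decay` — if moreover `‖ψ_k(x)‖ ≤ (C/c_k) e^{−a/c_k}`
  for `|x| ≥ s` (`a > 0`), then `‖ψ_k^{(2m)}(x)‖ ≤ 2^m (m+1) C (2m+1)! / a^{2m+1}` for `|x| ≥ s` — a bound
  that does not depend on `c` (from `u^n/n! ≤ e^u`, i.e. `sup_{c>0} c^{−n} e^{−a/c} ≤ n!/a^n`);
* `KernelChain.norm_deriv_le_of_norm_le_of_norm_iteratedDeriv_two_le` — the elementary interpolation
  `‖u′(x)‖ ≤ 2 sup ‖u‖ + sup ‖u″‖` over a unit interval with endpoint `x` (mean value inequality), which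
  gives the odd orders from the even ones WITHOUT shrinking the region `|x| ≥ s` (use the unit interval
  pointing away from the origin): `KernelChain.norm_iteratedDeriv_two_mul_add_one_le_of_decay`;
* `KernelChain.exists_uniform_norm_iteratedDeriv_le` — the packaged statement: for all `C a s`, `a > 0`,
  THERE IS `K : ℕ → ℝ` such that FOR EVERY such family, `‖ψ_k^{(n)}(x)‖ ≤ K n` for `|x| ≥ s` (the
  quantifier order — `K` before the sequence — is the one the inductive choice of the sequence in
  [DixmierMalliavin1978, §2] / [Hegde2021, Lemma 14] requires); variants `…_of_global_decay` (decay
  hypothesis `‖ψ_k(x)‖ ≤ (C/c_k) e^{−|x|/(2c_k)}` on all of `ℝ`) and `…_complex` (recursion written with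
  complex division).
-/

namespace Literature.Analysis.Convolution

namespace KernelChain

open Set
open scoped ContDiff Nat

variable {E : Type*} [NormedAddCommGroup E] [NormedSpace ℝ E]

/-! ### Calculus helpers -/

/-- `f^{(m+n)} = (f^{(n)})^{(m)}`. [folklore] -/
private theorem iteratedDeriv_add_eq (f : ℝ → E) (m n : ℕ) :
    iteratedDeriv (m + n) f = iteratedDeriv m (iteratedDeriv n f) := by
  rw [iteratedDeriv_eq_iterate, iteratedDeriv_eq_iterate, iteratedDeriv_eq_iterate,
    Function.iterate_add_apply]

/-- Iterated derivatives of a smooth function are smooth. [folklore] -/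
private theorem contDiff_iteratedDeriv_infty {f : ℝ → E} (hf : ContDiff ℝ ∞ f) (n : ℕ) :
    ContDiff ℝ ∞ (iteratedDeriv n f) := by
  rw [iteratedDeriv_eq_iterate]
  exact hf.iterate_deriv n

/-- `e⁻² d⁻ⁿ ≤ d⁻⁽ⁿ⁺²⁾` for `0 < d ≤ e`. [folklore] -/
private theorem inv_sq_mul_inv_pow_le {d e : ℝ} (hd : 0 < d) (hde : d ≤ e) (n : ℕ) :
    (e ^ 2)⁻¹ * (d ^ n)⁻¹ ≤ (d ^ (n + 2))⁻¹ := by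
  have h1 : d ^ (n + 2) ≤ e ^ 2 * d ^ n := by
    rw [pow_add, mul_comm]
    exact mul_le_mul_of_nonneg_right (pow_le_pow_left₀ hd.le hde 2) (by positivity)
  calc (e ^ 2)⁻¹ * (d ^ n)⁻¹ = (e ^ 2 * d ^ n)⁻¹ := by rw [mul_inv]
    _ ≤ (d ^ (n + 2))⁻¹ := inv_anti₀ (by positivity) h1

/-- `sup_{d > 0} d⁻ⁿ e^{−a/d} ≤ n!/aⁿ`, i.e. `uⁿ e^{−u} ≤ n!`. [folklore] -/
private theorem inv_pow_mul_exp_neg_div_le {d a : ℝ} (hd : 0 < d) (ha : 0 < a) (n : ℕ) :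
    (d ^ n)⁻¹ * Real.exp (-(a / d)) ≤ n ! / a ^ n := by
  have hu : 0 < a / d := div_pos ha hd
  have key : (a / d) ^ n ≤ Real.exp (a / d) * n ! := by
    have h : (a / d) ^ n / n ! ≤ Real.exp (a / d) := Real.pow_div_factorial_le_exp (x := a / d) hu.le n
    rwa [div_le_iff₀ (by positivity)] at h
  have key' : (a / d) ^ n * Real.exp (-(a / d)) ≤ n ! := by
    rw [Real.exp_neg, ← div_eq_mul_inv, div_le_iff₀ (Real.exp_pos _)]
    linarith
  have h1 : (d ^ n)⁻¹ = (a / d) ^ n / a ^ n := by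
    rw [div_pow, div_div, mul_comm, ← div_div, div_self (by positivity), one_div]
  calc (d ^ n)⁻¹ * Real.exp (-(a / d)) = (a / d) ^ n * Real.exp (-(a / d)) / a ^ n := by
        rw [h1]; ring
    _ ≤ n ! / a ^ n := div_le_div_of_nonneg_right key' (by positivity)

omit [NormedSpace ℝ E] in
/-- If `‖v‖ ≤ (C/d)·eᵗ` with `d > 0` then `C ≥ 0`. [folklore] -/
private theorem nonneg_of_norm_le {v : E} {C d t : ℝ} (hd : 0 < d)
    (h : ‖v‖ ≤ C / d * Real.exp t) : 0 ≤ C := by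
  by_contra hC
  replace hC : C < 0 := lt_of_not_ge hC
  have : C / d * Real.exp t < 0 :=
    mul_neg_of_neg_of_pos (div_neg_of_neg_of_pos hC hd) (Real.exp_pos t)
  linarith [norm_nonneg v]

/-! ### Even orders: the recursion `ψ_k″ = c_k⁻² • (ψ_k − ψ_{k+1})` iterated -/

/-- **Even-order derivatives of a Dixmier–Malliavin kernel chain are controlled by the chain itself.**
If `ψ_k″ = c_k⁻² (ψ_k − ψ_{k+1})` for a positive antitone sequence `c`, then for every `m`, `k`, `x`,
`‖ψ_k^{(2m)}(x)‖ ≤ 2^m Σ_{j ≤ m} c_{k+j}^{−2m} ‖ψ_{k+j}(x)‖`.  This is the bookkeeping behind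
"`ψ^{(2r)}` is a signed combination of the `ψ_{≥k}` over products of `c_j⁻²`" in the construction of
[DixmierMalliavin1978, §2] as used in [cite: Hegde2021, §3.2, proof of Lemma 14 (bounds on `|x| ≥ 1`)];
the recursion itself is `p_c″ = (p_c − δ)/c²` for the Laplace density `p_c = (2c)⁻¹e^{−|x|/c}`,
equivalently `(2πiξ)²/P_k(ξ) = (1/P_k(ξ) − 1/P_{k+1}(ξ))/c_k²` for `P_k(ξ) = Π_{n≥k}(1 + (2πc_nξ)²)`. -/
theorem norm_iteratedDeriv_two_mul_le_sum {ψ : ℕ → ℝ → E} {c : ℕ → ℝ}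
    (hc : ∀ k, 0 < c k) (hanti : Antitone c) (hψ : ∀ k, ContDiff ℝ ∞ (ψ k))
    (hrec : ∀ k x, iteratedDeriv 2 (ψ k) x = ((c k) ^ 2)⁻¹ • (ψ k x - ψ (k + 1) x))
    (m k : ℕ) (x : ℝ) :
    ‖iteratedDeriv (2 * m) (ψ k) x‖ ≤
      2 ^ m * ∑ j ∈ Finset.range (m + 1), ((c (k + j)) ^ (2 * m))⁻¹ * ‖ψ (k + j) x‖ := by
  induction m generalizing k with
  | zero => simp
  | succ m ih =>
    have hcd : ∀ k' (n : ℕ), ContDiffAt ℝ n (ψ k') x := fun k' n =>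
      ((hψ k').of_le (by exact_mod_cast le_top)).contDiffAt
    have hfun : iteratedDeriv 2 (ψ k) = ((c k) ^ 2)⁻¹ • (ψ k - ψ (k + 1)) := by
      funext y
      simpa only [Pi.smul_apply, Pi.sub_apply] using hrec k y
    have hsplit : iteratedDeriv (2 * (m + 1)) (ψ k) x =
        ((c k) ^ 2)⁻¹ • (iteratedDeriv (2 * m) (ψ k) x - iteratedDeriv (2 * m) (ψ (k + 1)) x) := by
      rw [show 2 * (m + 1) = 2 * m + 2 by ring, iteratedDeriv_add_eq, hfun,
        iteratedDeriv_const_smul_field, iteratedDeriv_sub (hcd k _) (hcd (k + 1) _)]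
    rw [hsplit, norm_smul, norm_inv, norm_pow, Real.norm_of_nonneg (hc k).le]
    set S : ℕ → ℝ := fun k' =>
      ∑ j ∈ Finset.range (m + 1), ((c (k' + j)) ^ (2 * m))⁻¹ * ‖ψ (k' + j) x‖ with hS
    set T : ℝ :=
      ∑ j ∈ Finset.range (m + 1 + 1), ((c (k + j)) ^ (2 * (m + 1)))⁻¹ * ‖ψ (k + j) x‖ with hT
    have hk : ‖iteratedDeriv (2 * m) (ψ k) x‖ ≤ 2 ^ m * S k := ih k
    have hk1 : ‖iteratedDeriv (2 * m) (ψ (k + 1)) x‖ ≤ 2 ^ m * S (k + 1) := ih (k + 1)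
    have h1 : ((c k) ^ 2)⁻¹ * S k ≤ T := by
      simp only [hS, hT, Finset.mul_sum]
      rw [Finset.sum_range_succ _ (m + 1)]
      have hlast : 0 ≤ ((c (k + (m + 1))) ^ (2 * (m + 1)))⁻¹ * ‖ψ (k + (m + 1)) x‖ := by
        have := hc (k + (m + 1)); positivity
      refine le_trans ?_ (le_add_of_nonneg_right hlast)
      refine Finset.sum_le_sum fun j _ => ?_
      rw [← mul_assoc]
      refine mul_le_mul_of_nonneg_right ?_ (norm_nonneg _)
      rw [show 2 * (m + 1) = 2 * m + 2 by ring]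
      exact inv_sq_mul_inv_pow_le (hc _) (hanti (Nat.le_add_right k j)) _
    have h2 : ((c k) ^ 2)⁻¹ * S (k + 1) ≤ T := by
      simp only [hS, hT, Finset.mul_sum]
      rw [Finset.sum_range_succ' _ (m + 1)]
      have hfirst : 0 ≤ ((c (k + 0)) ^ (2 * (m + 1)))⁻¹ * ‖ψ (k + 0) x‖ := by
        have := hc (k + 0); positivity
      refine le_trans ?_ (le_add_of_nonneg_right hfirst)
      refine Finset.sum_le_sum fun j _ => ?_
      rw [← mul_assoc, show k + 1 + j = k + (j + 1) by ring]
      refine mul_le_mul_of_nonneg_right ?_ (norm_nonneg _)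
      rw [show 2 * (m + 1) = 2 * m + 2 by ring]
      exact inv_sq_mul_inv_pow_le (hc _) (hanti (Nat.le_add_right k (j + 1))) _
    have hck : 0 ≤ ((c k) ^ 2)⁻¹ := by have := hc k; positivity
    calc ((c k) ^ 2)⁻¹ * ‖iteratedDeriv (2 * m) (ψ k) x - iteratedDeriv (2 * m) (ψ (k + 1)) x‖
        ≤ ((c k) ^ 2)⁻¹ * (2 ^ m * S k + 2 ^ m * S (k + 1)) :=
          mul_le_mul_of_nonneg_left ((norm_sub_le _ _).trans (add_le_add hk hk1)) hck
      _ = 2 ^ m * (((c k) ^ 2)⁻¹ * S k + ((c k) ^ 2)⁻¹ * S (k + 1)) := by ring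
      _ ≤ 2 ^ m * (T + T) := by gcongr
      _ = 2 ^ (m + 1) * T := by ring

/-- **Uniform even-order bounds away from the origin** ([cite: Hegde2021, §3.2, proof of Lemma 14
(the bounds `c_n` "independent of the sequence" on `|x| ≥ 1`)]; [DixmierMalliavin1978, §2]).  If, in
addition to the recursion, the chain satisfies the density/decay bound `‖ψ_k(x)‖ ≤ (C/c_k) e^{−a/c_k}`
on `|x| ≥ s` (`a > 0`), then on `|x| ≥ s`
`‖ψ_k^{(2m)}(x)‖ ≤ 2^m (m+1) C (2m+1)! / a^{2m+1}` — a bound INDEPENDENT of the sequence `c`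
(every term of `norm_iteratedDeriv_two_mul_le_sum` is `≤ C c_j^{−(2m+1)} e^{−a/c_j} ≤ C (2m+1)!/a^{2m+1}`). -/
theorem norm_iteratedDeriv_two_mul_le_of_decay {ψ : ℕ → ℝ → E} {c : ℕ → ℝ} {C a s : ℝ}
    (hc : ∀ k, 0 < c k) (hanti : Antitone c) (hψ : ∀ k, ContDiff ℝ ∞ (ψ k))
    (hrec : ∀ k x, iteratedDeriv 2 (ψ k) x = ((c k) ^ 2)⁻¹ • (ψ k x - ψ (k + 1) x))
    (ha : 0 < a) (hdec : ∀ k x, s ≤ |x| → ‖ψ k x‖ ≤ C / c k * Real.exp (-(a / c k)))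
    (m k : ℕ) {x : ℝ} (hx : s ≤ |x|) :
    ‖iteratedDeriv (2 * m) (ψ k) x‖ ≤
      2 ^ m * ((m + 1) * (C * ((2 * m + 1)! / a ^ (2 * m + 1)))) := by
  have hC : 0 ≤ C := nonneg_of_norm_le (hc k) (hdec k x hx)
  refine (norm_iteratedDeriv_two_mul_le_sum hc hanti hψ hrec m k x).trans ?_
  refine mul_le_mul_of_nonneg_left ?_ (by positivity)
  calc ∑ j ∈ Finset.range (m + 1), ((c (k + j)) ^ (2 * m))⁻¹ * ‖ψ (k + j) x‖
      ≤ ∑ j ∈ Finset.range (m + 1), C * ((2 * m + 1)! / a ^ (2 * m + 1)) := by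
        refine Finset.sum_le_sum fun j _ => ?_
        have hcj := hc (k + j)
        calc ((c (k + j)) ^ (2 * m))⁻¹ * ‖ψ (k + j) x‖
            ≤ ((c (k + j)) ^ (2 * m))⁻¹ * (C / c (k + j) * Real.exp (-(a / c (k + j)))) :=
              mul_le_mul_of_nonneg_left (hdec _ x hx) (by positivity)
          _ = C * (((c (k + j)) ^ (2 * m + 1))⁻¹ * Real.exp (-(a / c (k + j)))) := by
              rw [pow_succ, mul_inv, div_eq_mul_inv]; ring
          _ ≤ C * ((2 * m + 1)! / a ^ (2 * m + 1)) :=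
              mul_le_mul_of_nonneg_left (inv_pow_mul_exp_neg_div_le hcj ha _) hC
    _ = (m + 1) * (C * ((2 * m + 1)! / a ^ (2 * m + 1))) := by
        rw [Finset.sum_const, Finset.card_range, nsmul_eq_mul]
        push_cast
        ring

/-! ### Odd orders: interpolation over a unit interval -/

/-- **Interpolation of the first derivative** ([folklore: Landau's inequality in its crudest form],
as used for the odd-order bounds in the Dixmier–Malliavin construction
[cite: Hegde2021, §3.2, proof of Lemma 14]): if `‖u‖ ≤ A` and `‖u″‖ ≤ B` on a segment with endpoints
`x`, `y`, `|y − x| = 1`, then `‖u′(x)‖ ≤ 2A + B`.  Proof: the mean value inequality applied to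
`z ↦ u(z) − (z − x)•u′(x)`, whose derivative `u′(z) − u′(x)` has norm `≤ B|z − x| ≤ B`. -/
theorem norm_deriv_le_of_norm_le_of_norm_iteratedDeriv_two_le {u : ℝ → E} {x y A B : ℝ}
    (hu : ContDiff ℝ 2 u) (hxy : |y - x| = 1)
    (h0 : ∀ z ∈ uIcc x y, ‖u z‖ ≤ A) (h2 : ∀ z ∈ uIcc x y, ‖iteratedDeriv 2 u z‖ ≤ B) :
    ‖deriv u x‖ ≤ 2 * A + B := by
  have hdu : Differentiable ℝ u := hu.differentiable (by norm_num)
  have hdv : Differentiable ℝ (deriv u) := hu.differentiable_deriv_two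
  have hd2 : deriv (deriv u) = iteratedDeriv 2 u := by
    rw [show (2 : ℕ) = 1 + 1 from rfl, iteratedDeriv_succ, iteratedDeriv_one]
  have hB : 0 ≤ B := (norm_nonneg _).trans (h2 x left_mem_uIcc)
  -- Step 1: `‖u′ z − u′ x‖ ≤ B ‖z − x‖` on the segment.
  have hv : ∀ z ∈ uIcc x y, ‖deriv u z - deriv u x‖ ≤ B * ‖z - x‖ := fun z hz =>
    (convex_uIcc x y).norm_image_sub_le_of_norm_hasDerivWithin_le
      (fun w _ => (hdv w).hasDerivAt.hasDerivWithinAt)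
      (fun w hw => by rw [hd2]; exact h2 w hw) left_mem_uIcc hz
  -- Step 2: the auxiliary function `g z = u z − (z − x) • u′ x`.
  have hg : ∀ z ∈ uIcc x y, HasDerivWithinAt (fun z => u z - (z - x) • deriv u x)
      (deriv u z - deriv u x) (uIcc x y) z := by
    intro z _
    have h1 : HasDerivAt u (deriv u z) z := (hdu z).hasDerivAt
    have h2' : HasDerivAt (fun z => (z - x) • deriv u x) ((1 : ℝ) • deriv u x) z :=
      ((hasDerivAt_id z).sub_const x).smul_const (deriv u x)
    rw [one_smul] at h2'
    exact (h1.sub h2').hasDerivWithinAt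
  have hbound : ∀ z ∈ uIcc x y, ‖deriv u z - deriv u x‖ ≤ B := by
    intro z hz
    refine (hv z hz).trans ?_
    have hz1 : ‖z - x‖ ≤ 1 := by
      rw [Real.norm_eq_abs, ← hxy]
      exact abs_sub_left_of_mem_uIcc hz
    calc B * ‖z - x‖ ≤ B * 1 := mul_le_mul_of_nonneg_left hz1 hB
      _ = B := mul_one B
  have hmain := (convex_uIcc x y).norm_image_sub_le_of_norm_hasDerivWithin_le hg hbound
    left_mem_uIcc right_mem_uIcc
  simp only [sub_self, zero_smul, sub_zero] at hmain
  rw [Real.norm_eq_abs, hxy, mul_one] at hmain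
  have hnorm : ‖deriv u x‖ = ‖(y - x) • deriv u x‖ := by
    rw [norm_smul, Real.norm_eq_abs, hxy, one_mul]
  have hA0 : ‖u x‖ ≤ A := h0 x left_mem_uIcc
  have hAy : ‖u y‖ ≤ A := h0 y right_mem_uIcc
  calc ‖deriv u x‖ = ‖(y - x) • deriv u x‖ := hnorm
    _ = ‖(u y - u x) - (u y - (y - x) • deriv u x - u x)‖ := by congr 1; abel
    _ ≤ ‖u y - u x‖ + ‖u y - (y - x) • deriv u x - u x‖ := norm_sub_le _ _
    _ ≤ (‖u y‖ + ‖u x‖) + B := add_le_add (norm_sub_le _ _) hmain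
    _ ≤ 2 * A + B := by linarith

/-- For `|x| ≥ s` there is a unit interval with endpoint `x` inside `{z : |z| ≥ s}` (the one pointing
away from the origin). [folklore] -/
private theorem exists_unit_interval_outward (s x : ℝ) (hx : s ≤ |x|) :
    ∃ y : ℝ, |y - x| = 1 ∧ ∀ z ∈ uIcc x y, s ≤ |z| := by
  rcases le_or_gt 0 x with hx0 | hx0
  · refine ⟨x + 1, by simp, fun z hz => ?_⟩
    rw [uIcc_of_le (by linarith)] at hz
    rw [abs_of_nonneg hx0] at hx
    exact hx.trans (hz.1.trans (le_abs_self z))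
  · refine ⟨x - 1, by simp, fun z hz => ?_⟩
    rw [uIcc_of_ge (by linarith)] at hz
    rw [abs_of_neg hx0] at hx
    have hzx : z ≤ x := hz.2
    calc s ≤ -x := hx
      _ ≤ -z := by linarith
      _ ≤ |z| := neg_le_abs z

/-- **Uniform odd-order bounds away from the origin** ([cite: Hegde2021, §3.2, proof of Lemma 14];
[DixmierMalliavin1978, §2]): under the recursion and the decay bound on `|x| ≥ s`,
`‖ψ_k^{(2m+1)}(x)‖ ≤ 2·K_{2m} + K_{2m+2}` on `|x| ≥ s`, with the even-order constants
`K_{2m} = 2^m (m+1) C (2m+1)!/a^{2m+1}` of `norm_iteratedDeriv_two_mul_le_of_decay` — by the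
unit-interval interpolation applied on the interval pointing away from the origin, so the region
`|x| ≥ s` is NOT shrunk. -/
theorem norm_iteratedDeriv_two_mul_add_one_le_of_decay {ψ : ℕ → ℝ → E} {c : ℕ → ℝ} {C a s : ℝ}
    (hc : ∀ k, 0 < c k) (hanti : Antitone c) (hψ : ∀ k, ContDiff ℝ ∞ (ψ k))
    (hrec : ∀ k x, iteratedDeriv 2 (ψ k) x = ((c k) ^ 2)⁻¹ • (ψ k x - ψ (k + 1) x))
    (ha : 0 < a) (hdec : ∀ k x, s ≤ |x| → ‖ψ k x‖ ≤ C / c k * Real.exp (-(a / c k)))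
    (m k : ℕ) {x : ℝ} (hx : s ≤ |x|) :
    ‖iteratedDeriv (2 * m + 1) (ψ k) x‖ ≤
      2 * (2 ^ m * ((m + 1) * (C * ((2 * m + 1)! / a ^ (2 * m + 1))))) +
        2 ^ (m + 1) * ((↑(m + 1) + 1) * (C * ((2 * (m + 1) + 1)! / a ^ (2 * (m + 1) + 1)))) := by
  obtain ⟨y, hxy, hsub⟩ := exists_unit_interval_outward s x hx
  have hu : ContDiff ℝ 2 (iteratedDeriv (2 * m) (ψ k)) := by
    exact_mod_cast contDiff_infty.1 (contDiff_iteratedDeriv_infty (hψ k) (2 * m)) 2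
  have hderiv : iteratedDeriv (2 * m + 1) (ψ k) = deriv (iteratedDeriv (2 * m) (ψ k)) :=
    iteratedDeriv_succ
  have hd2 : iteratedDeriv 2 (iteratedDeriv (2 * m) (ψ k)) = iteratedDeriv (2 * (m + 1)) (ψ k) := by
    rw [show 2 * (m + 1) = 2 + 2 * m by ring]
    exact (iteratedDeriv_add_eq _ 2 (2 * m)).symm
  rw [hderiv]
  refine norm_deriv_le_of_norm_le_of_norm_iteratedDeriv_two_le hu hxy (fun z hz => ?_)
    (fun z hz => ?_)
  · exact norm_iteratedDeriv_two_mul_le_of_decay hc hanti hψ hrec ha hdec m k (hsub z hz)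
  · rw [hd2]
    exact_mod_cast norm_iteratedDeriv_two_mul_le_of_decay hc hanti hψ hrec ha hdec (m + 1) k
      (hsub z hz)

/-! ### The packaged uniform statement -/

/-- **Uniform derivative bounds away from the origin for Dixmier–Malliavin kernel chains — all
orders, constants chosen BEFORE the sequence** ([cite: Hegde2021, §3.2, Claim 13 in its corrected
away-from-the-origin form and the proof of Lemma 14]; [DixmierMalliavin1978, §2]).  Given `C`, `a > 0`
and `s`, there is `K : ℕ → ℝ` such that for EVERY smooth family `ψ : ℕ → ℝ → E` and EVERY positive
antitone sequence `c` with `ψ_k″ = c_k⁻² • (ψ_k − ψ_{k+1})` and `‖ψ_k(x)‖ ≤ (C/c_k)e^{−a/c_k}` on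
`|x| ≥ s`: `‖ψ_k^{(n)}(x)‖ ≤ K n` for all `n`, `k` and all `|x| ≥ s`. -/
theorem exists_uniform_norm_iteratedDeriv_le (C a s : ℝ) (ha : 0 < a) :
    ∃ K : ℕ → ℝ, ∀ (ψ : ℕ → ℝ → E) (c : ℕ → ℝ), (∀ k, 0 < c k) → Antitone c →
      (∀ k, ContDiff ℝ ∞ (ψ k)) →
      (∀ k x, iteratedDeriv 2 (ψ k) x = ((c k) ^ 2)⁻¹ • (ψ k x - ψ (k + 1) x)) →
      (∀ k x, s ≤ |x| → ‖ψ k x‖ ≤ C / c k * Real.exp (-(a / c k))) →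
      ∀ (n k : ℕ) (x : ℝ), s ≤ |x| → ‖iteratedDeriv n (ψ k) x‖ ≤ K n := by
  let F : ℕ → ℝ := fun m => 2 ^ m * ((m + 1) * (C * ((2 * m + 1)! / a ^ (2 * m + 1))))
  refine ⟨fun n => 3 * F (n / 2) + F (n / 2 + 1), ?_⟩
  intro ψ c hc hanti hψ hrec hdec n k x hx
  have hC : 0 ≤ C := nonneg_of_norm_le (hc k) (hdec k x hx)
  have hF : ∀ m, 0 ≤ F m := fun m => by positivity
  obtain ⟨m, rfl | rfl⟩ := Nat.even_or_odd' n
  · have hdiv : 2 * m / 2 = m := by omega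
    simp only [hdiv]
    have h := norm_iteratedDeriv_two_mul_le_of_decay hc hanti hψ hrec ha hdec m k hx
    have hFm : F m = 2 ^ m * ((m + 1) * (C * ((2 * m + 1)! / a ^ (2 * m + 1)))) := rfl
    linarith [hF m, hF (m + 1)]
  · have hdiv : (2 * m + 1) / 2 = m := by omega
    simp only [hdiv]
    have h := norm_iteratedDeriv_two_mul_add_one_le_of_decay hc hanti hψ hrec ha hdec m k hx
    have hFm : F m = 2 ^ m * ((m + 1) * (C * ((2 * m + 1)! / a ^ (2 * m + 1)))) := rfl
    have hF1 : F (m + 1) =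
        2 ^ (m + 1) * ((↑(m + 1) + 1) * (C * ((2 * (m + 1) + 1)! / a ^ (2 * (m + 1) + 1)))) := rfl
    linarith [hF m]

/-- The same packaged statement from a GLOBAL decay hypothesis `‖ψ_k(x)‖ ≤ (C/c_k) e^{−|x|/(2c_k)}`
(the form a contour shift of `∫ e^{2πixξ}/P_k(ξ) dξ` to `|Im ζ| = 1/(4πc_k)` produces), for any
`s > 0` ([cite: Hegde2021, §3.2, proof of Lemma 14]; [DixmierMalliavin1978, §2]). -/
theorem exists_uniform_norm_iteratedDeriv_le_of_global_decay (C s : ℝ) (hs : 0 < s) :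
    ∃ K : ℕ → ℝ, ∀ (ψ : ℕ → ℝ → E) (c : ℕ → ℝ), (∀ k, 0 < c k) → Antitone c →
      (∀ k, ContDiff ℝ ∞ (ψ k)) →
      (∀ k x, iteratedDeriv 2 (ψ k) x = ((c k) ^ 2)⁻¹ • (ψ k x - ψ (k + 1) x)) →
      (∀ k x, ‖ψ k x‖ ≤ C / c k * Real.exp (-(|x| / (2 * c k)))) →
      ∀ (n k : ℕ) (x : ℝ), s ≤ |x| → ‖iteratedDeriv n (ψ k) x‖ ≤ K n := by
  obtain ⟨K, hK⟩ := exists_uniform_norm_iteratedDeriv_le (E := E) C (s / 2) s (by positivity)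
  refine ⟨K, fun ψ c hc hanti hψ hrec hdec => hK ψ c hc hanti hψ hrec fun k x hx => ?_⟩
  have hC : 0 ≤ C := nonneg_of_norm_le (hc k) (hdec k x)
  refine (hdec k x).trans (mul_le_mul_of_nonneg_left ?_ (div_nonneg hC (hc k).le))
  refine Real.exp_le_exp.2 (neg_le_neg ?_)
  rw [div_div]
  exact div_le_div_of_nonneg_right hx (by have := hc k; positivity)

/-- Complex-valued chains with the recursion written as a complex division
`ψ_k″(x) = (ψ_k(x) − ψ_{k+1}(x)) / c_k²` ([cite: Hegde2021, §3.2, proof of Lemma 14];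
[DixmierMalliavin1978, §2]). -/
theorem exists_uniform_norm_iteratedDeriv_le_complex (C a s : ℝ) (ha : 0 < a) :
    ∃ K : ℕ → ℝ, ∀ (ψ : ℕ → ℝ → ℂ) (c : ℕ → ℝ), (∀ k, 0 < c k) → Antitone c →
      (∀ k, ContDiff ℝ ∞ (ψ k)) →
      (∀ k x, iteratedDeriv 2 (ψ k) x = (ψ k x - ψ (k + 1) x) / ((c k : ℂ)) ^ 2) →
      (∀ k x, s ≤ |x| → ‖ψ k x‖ ≤ C / c k * Real.exp (-(a / c k))) →
      ∀ (n k : ℕ) (x : ℝ), s ≤ |x| → ‖iteratedDeriv n (ψ k) x‖ ≤ K n := by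
  obtain ⟨K, hK⟩ := exists_uniform_norm_iteratedDeriv_le (E := ℂ) C a s ha
  refine ⟨K, fun ψ c hc hanti hψ hrec hdec => hK ψ c hc hanti hψ (fun k x => ?_) hdec⟩
  rw [hrec k x, div_eq_inv_mul, ← Complex.ofReal_pow, ← Complex.ofReal_inv, ← Complex.real_smul]

/-- Complex-valued chains, global decay hypothesis, any `s > 0`
([cite: Hegde2021, §3.2, proof of Lemma 14]; [DixmierMalliavin1978, §2]). -/
theorem exists_uniform_norm_iteratedDeriv_le_complex_of_global_decay (C s : ℝ) (hs : 0 < s) :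
    ∃ K : ℕ → ℝ, ∀ (ψ : ℕ → ℝ → ℂ) (c : ℕ → ℝ), (∀ k, 0 < c k) → Antitone c →
      (∀ k, ContDiff ℝ ∞ (ψ k)) →
      (∀ k x, iteratedDeriv 2 (ψ k) x = (ψ k x - ψ (k + 1) x) / ((c k : ℂ)) ^ 2) →
      (∀ k x, ‖ψ k x‖ ≤ C / c k * Real.exp (-(|x| / (2 * c k)))) →
      ∀ (n k : ℕ) (x : ℝ), s ≤ |x| → ‖iteratedDeriv n (ψ k) x‖ ≤ K n := by
  obtain ⟨K, hK⟩ := exists_uniform_norm_iteratedDeriv_le_of_global_decay (E := ℂ) C s hs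
  refine ⟨K, fun ψ c hc hanti hψ hrec hdec => hK ψ c hc hanti hψ (fun k x => ?_) hdec⟩
  rw [hrec k x, div_eq_inv_mul, ← Complex.ofReal_pow, ← Complex.ofReal_inv, ← Complex.real_smul]

end KernelChain

end Literature.Analysis.Convolution
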